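import Literature.NumberTheory.Connes2026.SemilocalCutoffScaleInvariance
import Literature.NumberTheory.Connes2026.SemilocalCutoffLimits
import Literature.Analysis.OperatorTheory.HilbertSchmidtComposition
import HarnessLib

/-!
# Connes 1999 Thm VII.4, `k = ℚ`, `S = {∞, p}` — THE MAIN (SHELL-LOCALISED) TERM OF THE ONE-PARAMETER FAMILY:
# `ϑ(g₁) Q' ϑ(g₂) Q P̂⁰_M K` is a pairing of Hilbert–Schmidt factors, uniformly in `M`, basis-independent on
# `L²(ℝ)_ev`, and its diagonal series converges as `M → ∞` to that of `ϑ(g₁) Q' ϑ(g₂) Q K`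

LABEL (line 1): RH-FREE literature (theorems only; NO definition, NO named fact).  bears_on: LADDER-RH
W-C/W-P (C1 named-fact debt), cell `rh-crit`, sub-cell cc, overflow row O1 — green layer under the row's last
named fact `Connes1999_thm_VII_4_rat`, eleventh file of the "annulus road" (after `AnnulusCorrectionLimit`,
which reduced the `P = {p}` case to properties (W0)–(W2) of the diagonal series of
`ϑ(g) P̂⁰_M Q₀(1) ϑ_{m log p}`).  WHAT THIS IS NOT: any claim about positivity, Weil's criterion or RH.

Sources.  A. Connes, Selecta Math. 5 (1999) [`Connes1999`], §VII proof of Thm 4 (29)–(33) (held text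
`paper:arxiv-math_9811068`, p0013); M. Reed, B. Simon (1972) [`ReedSimon1972`], Thm. VI.22, VI.24.

## What is proved

For `g₁, g₂ ∈ C_c(ℝ)`, shells `Q' = Q_{a',b'}`, `Q = Q_{a,b}` (`0 < a ≤ b`, `0 < a' ≤ b'`), a bounded `K` on
`L²(ℝ)` and the ultraviolet cutoffs `P̂⁰_M` — the operators
`X_M = ϑ(g₁) Q' ϑ(g₂) Q P̂⁰_M K` and `X_∞ = ϑ(g₁) Q' ϑ(g₂) Q K` (after Dixmier–Malliavin `ϑ(g) = Σ ϑ(g₁)ϑ(g₂)`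
and support propagation `ϑ(g₂) Q = Q' ϑ(g₂) Q`, these are the shell-localised parts of
`ϑ(g) P̂⁰_M Q₀(1) ϑ_{m log p}` with `K = Q₀(1) ϑ_{m log p}`, resp. of their cutoff-free limits):

* `inner_mainTerm_eq_pairing` — `⟨v, X_M v⟩ = ⟨(ϑ(g₁)Q')† v, (ϑ(g₂)Q) P̂⁰_M K v⟩` (a pairing of an
  Hilbert–Schmidt vector family with a Hilbert–Schmidt operator applied through the contraction `P̂⁰_M K`);
* **`summable_norm_inner_mainTerm`** (W1-type) — along every Hilbert basis `(f_i)` of `L²(ℝ)_ev`,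
  `Σ_i |⟨f_i, X_M f_i⟩| ≤ (H₁)^{1/2} ‖K‖ (H₂)^{1/2}` with the full Hilbert–Schmidt sums `H₁ = ∫∫|k^{Q'}_{g₁}|²`,
  `H₂ = ∫∫|k^{Q}_{g₂}|²` — UNIFORM in `M`, in `K` with `‖K‖ ≤ 1`, and in the basis;
* **`tsum_inner_mainTerm_eq_of_hilbertBasis`** (W0-type) — the sum does not depend on the Hilbert basis of `L²(ℝ)_ev`;
* **`tendsto_tsum_inner_mainTerm`** (W2-type, cutoff removal) — `Σ_i ⟨f_i, X_M f_i⟩ → Σ_i ⟨f_i, X_∞ f_i⟩`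
  as `M → ∞` (`HilbertSchmidtComposition.tendsto_tsum_inner_comp_strongly` with `P̂⁰_M = (P̂⁰_M)† → 1`).

What remains for (W0)–(W2) of `AnnulusCorrectionLimit` after this file: the complementary OFF-SHELL part
`ϑ(g)(1 − Q') P̂⁰_M Q₀` (separated sinc kernel) and the trace VALUE `Σ_i ⟨f_i, ϑ(h) Q_{a,b} f_i⟩ = h(0) log(b/a)`.

No instance, notation or attribute; no `def`.
-/

noncomputable section

open _root_.MeasureTheory Complex Set Filter
open scoped Real Topology ComplexConjugate ENNReal InnerProductSpace

namespace Literature.NumberTheory.Connes2026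

open Literature.NumberTheory.LFunctions Literature.Analysis.OperatorTheory
open Literature.NumberTheory.ConnesConsani
open Literature.NumberTheory.ConnesConsani2024
open Literature.NumberTheory.ConnesConsani2021 hiding cutoffProj cutoffProj_coeFn

variable {g₁ g₂ : ℝ → ℂ}

/-- `⟨v, ϑ(g₁) Q' Y v⟩ = ⟨(ϑ(g₁) Q')† v, Y v⟩`: the main term is a pairing. [cite: ReedSimon1972, Thm. VI.22 (e), PDF p. 198] -/
theorem inner_mainTerm_eq_pairing (a' b' : ℝ) (Y : Lp ℂ 2 (volume : Measure ℝ) →L[ℂ] Lp ℂ 2 (volume : Measure ℝ))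
    (v : Lp ℂ 2 (volume : Measure ℝ)) :
    ⟪v, (scalingOp g₁ ∘L shellProj a' b' ∘L Y) v⟫_ℂ =
      ⟪ContinuousLinearMap.adjoint (scalingOp g₁ ∘L shellProj a' b') v, Y v⟫_ℂ := by
  rw [ContinuousLinearMap.adjoint_inner_left]
  simp only [ContinuousLinearMap.comp_apply]

/-- The Hilbert–Schmidt data used below: along an arbitrary Hilbert basis `(c_k)` of `L²(ℝ)`,
`Σ_k ‖ϑ(g) Q_{a,b} c_k‖² = ∫∫ |k^Q_g|²` (from `hasSum_norm_sq_scalingOp_shellProj`). [cite: ReedSimon1972, Thm. VI.23, PDF p. 199] -/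
theorem summable_norm_sq_scalingOp_shellProj_basis {g : ℝ → ℂ} (hg : Continuous g) (hgs : HasCompactSupport g)
    {a b : ℝ} (ha : 0 < a) (hab : a ≤ b) {κ : Type*} (c : HilbertBasis κ ℂ (Lp ℂ 2 (volume : Measure ℝ))) :
    Summable (fun k => ‖(scalingOp g ∘L shellProj a b) (c k)‖ ^ 2) ∧
      ∑' k, ‖(scalingOp g ∘L shellProj a b) (c k)‖ ^ 2 = ∫ v, ∫ y, ‖shellScalingKernel g a b v y‖ ^ 2 := by
  have h := hasSum_norm_sq_scalingOp_shellProj hg hgs ha hab c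
  simp only [← ContinuousLinearMap.comp_apply] at h
  exact ⟨h.summable, h.tsum_eq⟩

section Main

variable (hg₁ : Continuous g₁) (hg₁s : HasCompactSupport g₁) (hg₂ : Continuous g₂) (hg₂s : HasCompactSupport g₂)
  {a b a' b' : ℝ} (ha : 0 < a) (hab : a ≤ b) (ha' : 0 < a') (hab' : a' ≤ b')

include hg₁ hg₁s hg₂ hg₂s ha hab ha' hab'

/-- **(W1-type) Uniform absolute bound for the main term.**  For every bounded `Y` on `L²(ℝ)` (e.g.
`Y = P̂⁰_M Q₀(1) ϑ_{m log p}`) and every Hilbert basis `(f_i)` of `L²(ℝ)_ev`, the diagonal series of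
`X = ϑ(g₁) Q' ϑ(g₂) Q Y` is absolutely summable with
`Σ_i |⟨f_i, X f_i⟩| ≤ (∫∫|k^{Q'}_{g₁}|²)^{1/2} · ‖Y‖ (∫∫|k^{Q}_{g₂}|²)^{1/2}` — uniform in `Y` through `‖Y‖` only
and independent of the basis. [cite: Connes1999, §VII proof of Thm 4 eqs. (29)–(33) (arXiv p0013); ReedSimon1972, Thm. VI.22 (c), (f), PDF p. 198] -/
theorem summable_norm_inner_mainTerm (Y : Lp ℂ 2 (volume : Measure ℝ) →L[ℂ] Lp ℂ 2 (volume : Measure ℝ))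
    {ι : Type*} (f : HilbertBasis ι ℂ (evenPart : Submodule ℂ (Lp ℂ 2 (volume : Measure ℝ)))) :
    Summable (fun i => ‖⟪((f i : evenPart) : Lp ℂ 2 (volume : Measure ℝ)),
        (scalingOp g₁ ∘L shellProj a' b' ∘L (scalingOp g₂ ∘L shellProj a b ∘L Y))
          ((f i : evenPart) : Lp ℂ 2 (volume : Measure ℝ))⟫_ℂ‖) ∧
      ∑' i, ‖⟪((f i : evenPart) : Lp ℂ 2 (volume : Measure ℝ)),
        (scalingOp g₁ ∘L shellProj a' b' ∘L (scalingOp g₂ ∘L shellProj a b ∘L Y))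
          ((f i : evenPart) : Lp ℂ 2 (volume : Measure ℝ))⟫_ℂ‖ ≤
        Real.sqrt (∫ v, ∫ y, ‖shellScalingKernel g₁ a' b' v y‖ ^ 2) *
          (‖Y‖ * Real.sqrt (∫ v, ∫ y, ‖shellScalingKernel g₂ a b v y‖ ^ 2)) := by
  obtain ⟨w, c, -⟩ := exists_hilbertBasis ℂ (Lp ℂ 2 (volume : Measure ℝ))
  have hv : Orthonormal ℂ (fun i => ((f i : evenPart) : Lp ℂ 2 (volume : Measure ℝ))) :=
    (evenPart.subtypeₗᵢ.orthonormal_comp_iff).mpr f.orthonormal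
  -- the left Hilbert–Schmidt family `u_i = (ϑ(g₁)Q')† f_i`
  obtain ⟨h1s, h1eq⟩ := summable_norm_sq_scalingOp_shellProj_basis hg₁ hg₁s ha' hab' c
  have hA : Summable (fun i => ‖ContinuousLinearMap.adjoint (scalingOp g₁ ∘L shellProj a' b')
      ((f i : evenPart) : Lp ℂ 2 (volume : Measure ℝ))‖ ^ 2) ∧
      ∑' i, ‖ContinuousLinearMap.adjoint (scalingOp g₁ ∘L shellProj a' b')
        ((f i : evenPart) : Lp ℂ 2 (volume : Measure ℝ))‖ ^ 2 ≤ ∫ v, ∫ y, ‖shellScalingKernel g₁ a' b' v y‖ ^ 2 := by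
    have hadj := ((hasSum_norm_sq_adjoint_iff c c (scalingOp g₁ ∘L shellProj a' b')).1 h1s.hasSum)
    have h := summable_norm_sq_apply_of_orthonormal c (ContinuousLinearMap.adjoint (scalingOp g₁ ∘L shellProj a' b'))
      hadj.summable hv
    rw [hadj.tsum_eq, h1eq] at h
    exact h
  -- the right Hilbert–Schmidt operator `C = ϑ(g₂) Q` through the bounded `Y`
  obtain ⟨h2s, h2eq⟩ := summable_norm_sq_scalingOp_shellProj_basis hg₂ hg₂s ha hab c
  have hB := summable_norm_sq_comp_apply c (scalingOp g₂ ∘L shellProj a b) h2s Y hv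
  rw [h2eq] at hB
  -- the pairing
  have hpair : ∀ i, ⟪((f i : evenPart) : Lp ℂ 2 (volume : Measure ℝ)),
      (scalingOp g₁ ∘L shellProj a' b' ∘L (scalingOp g₂ ∘L shellProj a b ∘L Y))
        ((f i : evenPart) : Lp ℂ 2 (volume : Measure ℝ))⟫_ℂ =
      ⟪ContinuousLinearMap.adjoint (scalingOp g₁ ∘L shellProj a' b') ((f i : evenPart) : Lp ℂ 2 (volume : Measure ℝ)),
        (scalingOp g₂ ∘L shellProj a b) (Y ((f i : evenPart) : Lp ℂ 2 (volume : Measure ℝ)))⟫_ℂ := fun i => by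
    rw [inner_mainTerm_eq_pairing]
    simp only [ContinuousLinearMap.comp_apply]
  simp_rw [hpair]
  have hprod := summable_norm_mul_norm_of_sq hA.1 hB.1
  have hsum : Summable fun i => ‖⟪ContinuousLinearMap.adjoint (scalingOp g₁ ∘L shellProj a' b')
      ((f i : evenPart) : Lp ℂ 2 (volume : Measure ℝ)),
      (scalingOp g₂ ∘L shellProj a b) (Y ((f i : evenPart) : Lp ℂ 2 (volume : Measure ℝ)))⟫_ℂ‖ :=
    Summable.of_nonneg_of_le (fun _ => norm_nonneg _) (fun i => norm_inner_le_norm _ _) hprod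
  refine ⟨hsum, ?_⟩
  refine (hsum.tsum_le_tsum (fun i => norm_inner_le_norm _ _) hprod).trans ?_
  refine (tsum_norm_mul_norm_le_sqrt hA.1 hB.1).trans ?_
  have hK : Real.sqrt (∑' i, ‖(scalingOp g₂ ∘L shellProj a b) (Y ((f i : evenPart) : Lp ℂ 2 (volume : Measure ℝ)))‖ ^ 2) ≤
      ‖Y‖ * Real.sqrt (∫ v, ∫ y, ‖shellScalingKernel g₂ a b v y‖ ^ 2) := by
    rw [← Real.sqrt_sq (norm_nonneg Y), ← Real.sqrt_mul (sq_nonneg _)]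
    exact Real.sqrt_le_sqrt hB.2
  exact mul_le_mul (Real.sqrt_le_sqrt hA.2) hK (Real.sqrt_nonneg _) (Real.sqrt_nonneg _)

/-- **(W0-type) The diagonal series of the main term does not depend on the Hilbert basis of `L²(ℝ)_ev`.** [cite: ReedSimon1972, Thm. VI.24, PDF p. 199] -/
theorem tsum_inner_mainTerm_eq_of_hilbertBasis (Y : Lp ℂ 2 (volume : Measure ℝ) →L[ℂ] Lp ℂ 2 (volume : Measure ℝ))
    {ι ι' : Type*} (f : HilbertBasis ι ℂ (evenPart : Submodule ℂ (Lp ℂ 2 (volume : Measure ℝ))))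
    (f' : HilbertBasis ι' ℂ (evenPart : Submodule ℂ (Lp ℂ 2 (volume : Measure ℝ)))) :
    ∑' i, ⟪((f i : evenPart) : Lp ℂ 2 (volume : Measure ℝ)),
        (scalingOp g₁ ∘L shellProj a' b' ∘L (scalingOp g₂ ∘L shellProj a b ∘L Y))
          ((f i : evenPart) : Lp ℂ 2 (volume : Measure ℝ))⟫_ℂ =
      ∑' i, ⟪((f' i : evenPart) : Lp ℂ 2 (volume : Measure ℝ)),
        (scalingOp g₁ ∘L shellProj a' b' ∘L (scalingOp g₂ ∘L shellProj a b ∘L Y))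
          ((f' i : evenPart) : Lp ℂ 2 (volume : Measure ℝ))⟫_ℂ := by
  haveI : CompleteSpace (evenPart : Submodule ℂ (Lp ℂ 2 (volume : Measure ℝ))) := completeSpace_evenPart
  obtain ⟨w, c, -⟩ := exists_hilbertBasis ℂ (Lp ℂ 2 (volume : Measure ℝ))
  have hv : Orthonormal ℂ (fun i => ((f i : evenPart) : Lp ℂ 2 (volume : Measure ℝ))) :=
    (evenPart.subtypeₗᵢ.orthonormal_comp_iff).mpr f.orthonormal
  obtain ⟨h1s, -⟩ := summable_norm_sq_scalingOp_shellProj_basis hg₁ hg₁s ha' hab' c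
  have hadj := ((hasSum_norm_sq_adjoint_iff c c (scalingOp g₁ ∘L shellProj a' b')).1 h1s.hasSum)
  have hA := (summable_norm_sq_apply_of_orthonormal c
    (ContinuousLinearMap.adjoint (scalingOp g₁ ∘L shellProj a' b')) hadj.summable hv).1
  obtain ⟨h2s, -⟩ := summable_norm_sq_scalingOp_shellProj_basis hg₂ hg₂s ha hab c
  have hB := (summable_norm_sq_comp_apply c (scalingOp g₂ ∘L shellProj a b) h2s Y hv).1
  have h := tsum_inner_apply_apply_eq_of_hilbertBasis_of_mem f f'
    (ContinuousLinearMap.adjoint (scalingOp g₁ ∘L shellProj a' b')) (scalingOp g₂ ∘L shellProj a b ∘L Y) hA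
    (by simpa only [ContinuousLinearMap.comp_apply] using hB)
  simp only [ContinuousLinearMap.comp_apply] at h
  simp_rw [inner_mainTerm_eq_pairing, ContinuousLinearMap.comp_apply]
  exact h

/-- **(W2-type) Removing the ultraviolet cutoff inside the main term**: for every bounded `K` and every Hilbert
basis `(f_i)` of `L²(ℝ)_ev`, `Σ_i ⟨f_i, ϑ(g₁) Q' ϑ(g₂) Q P̂⁰_M K f_i⟩ → Σ_i ⟨f_i, ϑ(g₁) Q' ϑ(g₂) Q K f_i⟩` as
`M → ∞` (`P̂⁰_M` is a self-adjoint contraction tending strongly to `1`). [cite: Connes1999, §VII Thm 4 ("when `Λ → ∞`") and proof eqs. (29)–(33) (arXiv p0013); ReedSimon1972, Thm. VI.22 (e), (f), PDF p. 198] -/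
theorem tendsto_tsum_inner_mainTerm (K : Lp ℂ 2 (volume : Measure ℝ) →L[ℂ] Lp ℂ 2 (volume : Measure ℝ))
    {ι : Type*} (f : HilbertBasis ι ℂ (evenPart : Submodule ℂ (Lp ℂ 2 (volume : Measure ℝ)))) :
    Tendsto (fun M : ℝ => ∑' i, ⟪((f i : evenPart) : Lp ℂ 2 (volume : Measure ℝ)),
        (scalingOp g₁ ∘L shellProj a' b' ∘L (scalingOp g₂ ∘L shellProj a b ∘L (dualCutoffProj ∅ M ∘L K)))
          ((f i : evenPart) : Lp ℂ 2 (volume : Measure ℝ))⟫_ℂ) atTop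
      (𝓝 (∑' i, ⟪((f i : evenPart) : Lp ℂ 2 (volume : Measure ℝ)),
        (scalingOp g₁ ∘L shellProj a' b' ∘L (scalingOp g₂ ∘L shellProj a b ∘L K))
          ((f i : evenPart) : Lp ℂ 2 (volume : Measure ℝ))⟫_ℂ)) := by
  obtain ⟨w, c, -⟩ := exists_hilbertBasis ℂ (Lp ℂ 2 (volume : Measure ℝ))
  have hv : Orthonormal ℂ (fun i => ((f i : evenPart) : Lp ℂ 2 (volume : Measure ℝ))) :=
    (evenPart.subtypeₗᵢ.orthonormal_comp_iff).mpr f.orthonormal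
  obtain ⟨h1s, -⟩ := summable_norm_sq_scalingOp_shellProj_basis hg₁ hg₁s ha' hab' c
  have hadj := ((hasSum_norm_sq_adjoint_iff c c (scalingOp g₁ ∘L shellProj a' b')).1 h1s.hasSum)
  have hu := (summable_norm_sq_apply_of_orthonormal c
    (ContinuousLinearMap.adjoint (scalingOp g₁ ∘L shellProj a' b')) hadj.summable hv).1
  obtain ⟨h2s, -⟩ := summable_norm_sq_scalingOp_shellProj_basis hg₂ hg₂s ha hab c
  have hP1 : ∀ (M : ℝ) (y : Lp ℂ 2 (volume : Measure ℝ)),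
      ‖ContinuousLinearMap.adjoint (dualCutoffProj ∅ M) y‖ ≤ ‖y‖ := fun M y => by
    rw [adjoint_dualCutoffProj]
    exact norm_dualCutoffProj_empty_le M y
  have hP2 : ∀ y : Lp ℂ 2 (volume : Measure ℝ),
      Tendsto (fun M : ℝ => ContinuousLinearMap.adjoint (dualCutoffProj ∅ M) y) atTop (𝓝 y) := fun y => by
    simp_rw [adjoint_dualCutoffProj]
    exact tendsto_dualCutoffProj_empty_atTop y
  have h := tendsto_tsum_inner_comp_strongly c (scalingOp g₂ ∘L shellProj a b) h2s K hv hu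
    (fun M : ℝ => dualCutoffProj ∅ M) hP1 hP2
  simp_rw [inner_mainTerm_eq_pairing, ContinuousLinearMap.comp_apply]
  simpa only [ContinuousLinearMap.comp_apply] using h

end Main

end Literature.NumberTheory.Connes2026
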